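import Summits.Ventures.CertifiedManyBodySolver.Downfold.EmeryBoxesCupratesLowerFace
import HarnessLib

/-!
# R-B12 annex in the tree: the LEVEL-TAGGED Δ_pd sub-boxes of La₂CuO₄'s 3BE box — `emeryBoxLa214DFT` (DFT-level
# Δ_pd ∈ [1.7, 2.92]) and `emeryBoxLa214Solver` (solver-level Δ_pd ∈ [3.24, 4.0]) — each REFINING `emeryBoxLa214`, with
# their own 4-corner lower-face doors

Venture CertifiedManyBodySolver, cell `pub/hubbard-downfold` (stage S1 = ROUTER), seat hubbard-downfold-mod-4; namespace
`Summit.Ventures.CertifiedManyBodySolver.Downfold`. Lead ruling R-B12 (2026-08-27T04:59:37Z, «ADMITTED AS ANNEX»): for the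
LEVEL-MIXED Δ_pd companion of La-214 (members: DFT-level {p/w3b 1.74–1.92, c 2.80–2.91, Weber 2.61}; solver-level {Kung 3.24,
empirical 3.25, cLDA 3.6, cGW-SIC 3.7}) EMERY-LINE may print two level-tagged six-boxes BESIDE the hull; the HULL (`emeryBoxLa214`)
stays the companion of record and a sub-box certificate is a sharper statement AT THAT LEVEL OBJECT ONLY. This file types the two
sub-boxes (all other entries = those of `emeryBoxLa214`):

* `emeryBoxLa214DFT` (Δ_pd ∈ [17/10, 73/25]) and `emeryBoxLa214Solver` (Δ_pd ∈ [81/25, 4]); `_mem_iff`;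
* `emeryBoxLa214DFT_refines` / `emeryBoxLa214Solver_refines` — each sub-box REFINES the hull box, so every hull word transfers
  DOWN to them (`HoldsOn.of_refines`), never up;
* `_energyFloor_lowerFace` — the sharper door: 4 corner certificates `(t_pd, t_pp) ∈ {1.29, 1.52} × {0.46, 0.66}` at the sub-box's
  OWN Δ lo (`1.7` resp. `3.24`), `ε_p = 0`, `U_d = 7`, `U_p = 3.4` (by `EmeryMonotoneVertexFloors`: e non-decreasing in ε_d, so the
  solver-level floor certified at Δ = 3.24 is the tighter statement the hull's floor at 1.7 cannot give).

Everything here is PROVED; SCREENING-GRADE boxes typed verbatim; nothing about the material is certified by typing.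
-/

namespace Summit.Ventures.CertifiedManyBodySolver.Downfold

open Literature.MathematicalPhysics.QuantumLattice

/-- `DeltaPd`, DFT-level sub-interval: [1.7, 2.92] (DFT-level members: p/w3b 1.74–1.92, c 2.80–2.91, Weber2012 2.61; box lo pad); R-B12 annex of router/BOXES/La2CuO4-family.md l.181. [folklore] -/
def la214DFTEmery_Delta : Entry := Entry.ofEnds (17/10) (73/25) (by norm_num) .screening

/-- **The DFT-level Δ sub-box of La₂CuO₄'s 3BE box** (R-B12 annex; all other entries as `emeryBoxLa214`). [folklore] -/
def emeryBoxLa214DFT : EmeryBox := fun c =>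
  match c with
  | .DeltaPd => some la214DFTEmery_Delta
  | .tpd => some la214Emery_tpd
  | .tpp => some la214Emery_tpp
  | .tppP => some la214Emery_tppP
  | .Udd => some la214Emery_Udd
  | .Upp => some la214Emery_Upp
  | .Vpd => some la214Emery_Vpd
  | .nHoles => some la214Emery_nH

/-- **Membership in `emeryBoxLa214DFT` unfolded.** [folklore] -/
theorem emeryBoxLa214DFT_mem_iff (p : EmeryCoord → ℝ) :
    emeryBoxLa214DFT.Mem p ↔
      (((17/10) : ℚ) : ℝ) ≤ p .DeltaPd ∧ p .DeltaPd ≤ (((73/25) : ℚ) : ℝ) ∧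
      (((129/100) : ℚ) : ℝ) ≤ p .tpd ∧ p .tpd ≤ (((38/25) : ℚ) : ℝ) ∧
      (((23/50) : ℚ) : ℝ) ≤ p .tpp ∧ p .tpp ≤ (((33/50) : ℚ) : ℝ) ∧
      (((3/25) : ℚ) : ℝ) ≤ p .tppP ∧ p .tppP ≤ (((3/20) : ℚ) : ℝ) ∧
      (((7) : ℚ) : ℝ) ≤ p .Udd ∧ p .Udd ≤ (((21/2) : ℚ) : ℝ) ∧
      (((17/5) : ℚ) : ℝ) ≤ p .Upp ∧ p .Upp ≤ (((116/25) : ℚ) : ℝ) ∧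
      (((57/100) : ℚ) : ℝ) ≤ p .Vpd ∧ p .Vpd ≤ (((47/25) : ℚ) : ℝ) ∧
      (((1) : ℚ) : ℝ) ≤ p .nHoles ∧ p .nHoles ≤ (((1) : ℚ) : ℝ) := by
  constructor
  · intro h
    have h0 := (Entry.mem_ofEnds_iff _ _ _ _ _).1 (h .DeltaPd la214DFTEmery_Delta rfl)
    have h1 := (Entry.mem_ofEnds_iff _ _ _ _ _).1 (h .tpd la214Emery_tpd rfl)
    have h2 := (Entry.mem_ofEnds_iff _ _ _ _ _).1 (h .tpp la214Emery_tpp rfl)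
    have h3 := (Entry.mem_ofEnds_iff _ _ _ _ _).1 (h .tppP la214Emery_tppP rfl)
    have h4 := (Entry.mem_ofEnds_iff _ _ _ _ _).1 (h .Udd la214Emery_Udd rfl)
    have h5 := (Entry.mem_ofEnds_iff _ _ _ _ _).1 (h .Upp la214Emery_Upp rfl)
    have h6 := (Entry.mem_ofEnds_iff _ _ _ _ _).1 (h .Vpd la214Emery_Vpd rfl)
    have h7 := (Entry.mem_ofEnds_iff _ _ _ _ _).1 (h .nHoles la214Emery_nH rfl)
    exact ⟨h0.1, h0.2, h1.1, h1.2, h2.1, h2.2, h3.1, h3.2, h4.1, h4.2, h5.1, h5.2, h6.1, h6.2, h7.1, h7.2⟩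
  · rintro ⟨a0, b0, a1, b1, a2, b2, a3, b3, a4, b4, a5, b5, a6, b6, a7, b7⟩ i e hi
    cases i <;> simp only [emeryBoxLa214DFT, Option.some.injEq] at hi <;> subst hi
    · exact (Entry.mem_ofEnds_iff _ _ _ _ _).2 ⟨a0, b0⟩
    · exact (Entry.mem_ofEnds_iff _ _ _ _ _).2 ⟨a1, b1⟩
    · exact (Entry.mem_ofEnds_iff _ _ _ _ _).2 ⟨a2, b2⟩
    · exact (Entry.mem_ofEnds_iff _ _ _ _ _).2 ⟨a3, b3⟩
    · exact (Entry.mem_ofEnds_iff _ _ _ _ _).2 ⟨a4, b4⟩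
    · exact (Entry.mem_ofEnds_iff _ _ _ _ _).2 ⟨a5, b5⟩
    · exact (Entry.mem_ofEnds_iff _ _ _ _ _).2 ⟨a6, b6⟩
    · exact (Entry.mem_ofEnds_iff _ _ _ _ _).2 ⟨a7, b7⟩

/-- **`emeryBoxLa214DFT` refines the hull box `emeryBoxLa214`** (Δ sub-interval inside [1.7, 4.0]; other entries equal):
every hull word transfers down to the sub-box. [folklore] -/
theorem emeryBoxLa214DFT_refines : emeryBoxLa214DFT.Refines emeryBoxLa214 := by
  intro p hp
  rw [emeryBoxLa214DFT_mem_iff] at hp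
  rw [emeryBoxLa214_mem_iff]
  obtain ⟨a0, b0, rest⟩ := hp
  have hlo : (((17/10 : ℚ)) : ℝ) ≤ (((17/10 : ℚ)) : ℝ) := by exact_mod_cast (by norm_num)
  have hhi : (((73/25 : ℚ)) : ℝ) ≤ (((4 : ℚ)) : ℝ) := by exact_mod_cast (by norm_num)
  exact ⟨hlo.trans a0, b0.trans hhi, rest⟩

/-- Hull words transfer to the DFT-level sub-box. [folklore] -/
theorem holdsOn_emeryBoxLa214DFT_of_hull {W : (EmeryCoord → ℝ) → Prop} (h : HoldsOn W emeryBoxLa214) :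
    HoldsOn W emeryBoxLa214DFT := h.of_refines emeryBoxLa214DFT_refines

/-- Lower corner of the DFT-level delivered six-box: `(129/100, 23/50, 17/10, 0, 7, 17/5)`. [folklore] -/
theorem la214DFT_emeryLo : emeryLo 0 la214Emery_tpd la214Emery_tpp la214DFTEmery_Delta la214Emery_Udd la214Emery_Upp = ![129/100, 23/50, 17/10, 0, 7, 17/5] := by
  ext i; fin_cases i <;> simp [emeryLo, la214Emery_tpd, la214Emery_tpp, la214DFTEmery_Delta, la214Emery_Udd, la214Emery_Upp]

/-- Upper corner of the DFT-level delivered six-box: `(38/25, 33/50, 73/25, 0, 21/2, 116/25)`. [folklore] -/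
theorem la214DFT_emeryHi : emeryHi 0 la214Emery_tpd la214Emery_tpp la214DFTEmery_Delta la214Emery_Udd la214Emery_Upp = ![38/25, 33/50, 73/25, 0, 21/2, 116/25] := by
  ext i; fin_cases i <;> simp [emeryHi, la214Emery_tpd, la214Emery_tpp, la214DFTEmery_Delta, la214Emery_Udd, la214Emery_Upp]

/-- The lower face of the DFT-level six-box: `(38/25, 33/50, 17/10, 0, 7, 17/5)`. [folklore] -/
theorem la214DFT_lowerFace : lowerFace (![129/100, 23/50, 17/10, 0, 7, 17/5] : Fin 6 → ℝ) ![38/25, 33/50, 73/25, 0, 21/2, 116/25] = ![38/25, 33/50, 17/10, 0, 7, 17/5] := by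
  ext i; fin_cases i <;> simp [lowerFace]

/-- **The sharper DFT-level door**: 4 corner certificates at the vertices of `Set.Icc (129/100, 23/50, 17/10, 0, 7, 17/5) (38/25, 33/50, 17/10, 0, 7, 17/5)` — i.e. at the sub-box's
own Δ lo — give a floor on `emeryBoxLa214DFT` (a statement at that level object only, R-B12). [cite: Israel1979, Thm. I.3.4] -/
theorem emeryBoxLa214DFT_energyFloor_lowerFace (s : Fin 4 → ℝ) (ρ : ℝ) {m : ℝ}
    (hm : ∀ v ∈ Fintype.piFinset (fun i => ({(![129/100, 23/50, 17/10, 0, 7, 17/5] : Fin 6 → ℝ) i, (![38/25, 33/50, 17/10, 0, 7, 17/5] : Fin 6 → ℝ) i} : Finset ℝ)),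
      m ≤ emeryEnergyDensity (emeryLine s v) ρ) :
    HoldsOn (fun p : EmeryCoord → ℝ => m ≤ emeryEnergyDensity (emeryLine s (emeryLineCoords 0 p)) ρ) emeryBoxLa214DFT := by
  have h := holdsOn_emeryEnergyFloor_lowerFace (E := emeryBoxLa214DFT) (εp := 0) (eA := la214Emery_tpd)
    (eB := la214Emery_tpp) (eD := la214DFTEmery_Delta) (eUd := la214Emery_Udd) (eUp := la214Emery_Upp)
    rfl rfl rfl rfl rfl s ρ (m := m) (by rw [la214DFT_emeryLo, la214DFT_emeryHi, la214DFT_lowerFace]; exact hm)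
  simpa using h

/-- `DeltaPd`, Solver-level sub-interval: [3.24, 4.0] (solver-level members: Kung2016 3.24, empirical 3.25, cLDA 3.6, cGW-SIC 3.7; box hi pad); R-B12 annex of router/BOXES/La2CuO4-family.md l.181. [folklore] -/
def la214SolverEmery_Delta : Entry := Entry.ofEnds (81/25) (4) (by norm_num) .screening

/-- **The Solver-level Δ sub-box of La₂CuO₄'s 3BE box** (R-B12 annex; all other entries as `emeryBoxLa214`). [folklore] -/
def emeryBoxLa214Solver : EmeryBox := fun c =>
  match c with
  | .DeltaPd => some la214SolverEmery_Delta
  | .tpd => some la214Emery_tpd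
  | .tpp => some la214Emery_tpp
  | .tppP => some la214Emery_tppP
  | .Udd => some la214Emery_Udd
  | .Upp => some la214Emery_Upp
  | .Vpd => some la214Emery_Vpd
  | .nHoles => some la214Emery_nH

/-- **Membership in `emeryBoxLa214Solver` unfolded.** [folklore] -/
theorem emeryBoxLa214Solver_mem_iff (p : EmeryCoord → ℝ) :
    emeryBoxLa214Solver.Mem p ↔
      (((81/25) : ℚ) : ℝ) ≤ p .DeltaPd ∧ p .DeltaPd ≤ (((4) : ℚ) : ℝ) ∧
      (((129/100) : ℚ) : ℝ) ≤ p .tpd ∧ p .tpd ≤ (((38/25) : ℚ) : ℝ) ∧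
      (((23/50) : ℚ) : ℝ) ≤ p .tpp ∧ p .tpp ≤ (((33/50) : ℚ) : ℝ) ∧
      (((3/25) : ℚ) : ℝ) ≤ p .tppP ∧ p .tppP ≤ (((3/20) : ℚ) : ℝ) ∧
      (((7) : ℚ) : ℝ) ≤ p .Udd ∧ p .Udd ≤ (((21/2) : ℚ) : ℝ) ∧
      (((17/5) : ℚ) : ℝ) ≤ p .Upp ∧ p .Upp ≤ (((116/25) : ℚ) : ℝ) ∧
      (((57/100) : ℚ) : ℝ) ≤ p .Vpd ∧ p .Vpd ≤ (((47/25) : ℚ) : ℝ) ∧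
      (((1) : ℚ) : ℝ) ≤ p .nHoles ∧ p .nHoles ≤ (((1) : ℚ) : ℝ) := by
  constructor
  · intro h
    have h0 := (Entry.mem_ofEnds_iff _ _ _ _ _).1 (h .DeltaPd la214SolverEmery_Delta rfl)
    have h1 := (Entry.mem_ofEnds_iff _ _ _ _ _).1 (h .tpd la214Emery_tpd rfl)
    have h2 := (Entry.mem_ofEnds_iff _ _ _ _ _).1 (h .tpp la214Emery_tpp rfl)
    have h3 := (Entry.mem_ofEnds_iff _ _ _ _ _).1 (h .tppP la214Emery_tppP rfl)
    have h4 := (Entry.mem_ofEnds_iff _ _ _ _ _).1 (h .Udd la214Emery_Udd rfl)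
    have h5 := (Entry.mem_ofEnds_iff _ _ _ _ _).1 (h .Upp la214Emery_Upp rfl)
    have h6 := (Entry.mem_ofEnds_iff _ _ _ _ _).1 (h .Vpd la214Emery_Vpd rfl)
    have h7 := (Entry.mem_ofEnds_iff _ _ _ _ _).1 (h .nHoles la214Emery_nH rfl)
    exact ⟨h0.1, h0.2, h1.1, h1.2, h2.1, h2.2, h3.1, h3.2, h4.1, h4.2, h5.1, h5.2, h6.1, h6.2, h7.1, h7.2⟩
  · rintro ⟨a0, b0, a1, b1, a2, b2, a3, b3, a4, b4, a5, b5, a6, b6, a7, b7⟩ i e hi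
    cases i <;> simp only [emeryBoxLa214Solver, Option.some.injEq] at hi <;> subst hi
    · exact (Entry.mem_ofEnds_iff _ _ _ _ _).2 ⟨a0, b0⟩
    · exact (Entry.mem_ofEnds_iff _ _ _ _ _).2 ⟨a1, b1⟩
    · exact (Entry.mem_ofEnds_iff _ _ _ _ _).2 ⟨a2, b2⟩
    · exact (Entry.mem_ofEnds_iff _ _ _ _ _).2 ⟨a3, b3⟩
    · exact (Entry.mem_ofEnds_iff _ _ _ _ _).2 ⟨a4, b4⟩
    · exact (Entry.mem_ofEnds_iff _ _ _ _ _).2 ⟨a5, b5⟩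
    · exact (Entry.mem_ofEnds_iff _ _ _ _ _).2 ⟨a6, b6⟩
    · exact (Entry.mem_ofEnds_iff _ _ _ _ _).2 ⟨a7, b7⟩

/-- **`emeryBoxLa214Solver` refines the hull box `emeryBoxLa214`** (Δ sub-interval inside [1.7, 4.0]; other entries equal):
every hull word transfers down to the sub-box. [folklore] -/
theorem emeryBoxLa214Solver_refines : emeryBoxLa214Solver.Refines emeryBoxLa214 := by
  intro p hp
  rw [emeryBoxLa214Solver_mem_iff] at hp
  rw [emeryBoxLa214_mem_iff]
  obtain ⟨a0, b0, rest⟩ := hp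
  have hlo : (((17/10 : ℚ)) : ℝ) ≤ (((81/25 : ℚ)) : ℝ) := by exact_mod_cast (by norm_num)
  have hhi : (((4 : ℚ)) : ℝ) ≤ (((4 : ℚ)) : ℝ) := by exact_mod_cast (by norm_num)
  exact ⟨hlo.trans a0, b0.trans hhi, rest⟩

/-- Hull words transfer to the Solver-level sub-box. [folklore] -/
theorem holdsOn_emeryBoxLa214Solver_of_hull {W : (EmeryCoord → ℝ) → Prop} (h : HoldsOn W emeryBoxLa214) :
    HoldsOn W emeryBoxLa214Solver := h.of_refines emeryBoxLa214Solver_refines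

/-- Lower corner of the Solver-level delivered six-box: `(129/100, 23/50, 81/25, 0, 7, 17/5)`. [folklore] -/
theorem la214Solver_emeryLo : emeryLo 0 la214Emery_tpd la214Emery_tpp la214SolverEmery_Delta la214Emery_Udd la214Emery_Upp = ![129/100, 23/50, 81/25, 0, 7, 17/5] := by
  ext i; fin_cases i <;> simp [emeryLo, la214Emery_tpd, la214Emery_tpp, la214SolverEmery_Delta, la214Emery_Udd, la214Emery_Upp]

/-- Upper corner of the Solver-level delivered six-box: `(38/25, 33/50, 4, 0, 21/2, 116/25)`. [folklore] -/
theorem la214Solver_emeryHi : emeryHi 0 la214Emery_tpd la214Emery_tpp la214SolverEmery_Delta la214Emery_Udd la214Emery_Upp = ![38/25, 33/50, 4, 0, 21/2, 116/25] := by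
  ext i; fin_cases i <;> simp [emeryHi, la214Emery_tpd, la214Emery_tpp, la214SolverEmery_Delta, la214Emery_Udd, la214Emery_Upp]

/-- The lower face of the Solver-level six-box: `(38/25, 33/50, 81/25, 0, 7, 17/5)`. [folklore] -/
theorem la214Solver_lowerFace : lowerFace (![129/100, 23/50, 81/25, 0, 7, 17/5] : Fin 6 → ℝ) ![38/25, 33/50, 4, 0, 21/2, 116/25] = ![38/25, 33/50, 81/25, 0, 7, 17/5] := by
  ext i; fin_cases i <;> simp [lowerFace]

/-- **The sharper Solver-level door**: 4 corner certificates at the vertices of `Set.Icc (129/100, 23/50, 81/25, 0, 7, 17/5) (38/25, 33/50, 81/25, 0, 7, 17/5)` — i.e. at the sub-box's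
own Δ lo — give a floor on `emeryBoxLa214Solver` (a statement at that level object only, R-B12). [cite: Israel1979, Thm. I.3.4] -/
theorem emeryBoxLa214Solver_energyFloor_lowerFace (s : Fin 4 → ℝ) (ρ : ℝ) {m : ℝ}
    (hm : ∀ v ∈ Fintype.piFinset (fun i => ({(![129/100, 23/50, 81/25, 0, 7, 17/5] : Fin 6 → ℝ) i, (![38/25, 33/50, 81/25, 0, 7, 17/5] : Fin 6 → ℝ) i} : Finset ℝ)),
      m ≤ emeryEnergyDensity (emeryLine s v) ρ) :
    HoldsOn (fun p : EmeryCoord → ℝ => m ≤ emeryEnergyDensity (emeryLine s (emeryLineCoords 0 p)) ρ) emeryBoxLa214Solver := by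
  have h := holdsOn_emeryEnergyFloor_lowerFace (E := emeryBoxLa214Solver) (εp := 0) (eA := la214Emery_tpd)
    (eB := la214Emery_tpp) (eD := la214SolverEmery_Delta) (eUd := la214Emery_Udd) (eUp := la214Emery_Upp)
    rfl rfl rfl rfl rfl s ρ (m := m) (by rw [la214Solver_emeryLo, la214Solver_emeryHi, la214Solver_lowerFace]; exact hm)
  simpa using h

end Summit.Ventures.CertifiedManyBodySolver.Downfold
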